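import Summits.MatrixMultiplication.OmegaCensus.STPPVosperSlackOneLawB2
import Summits.MatrixMultiplication.OmegaCensus.STPPVosperSlackOneKillsB2Z59Rows1
import Summits.MatrixMultiplication.OmegaCensus.STPPVosperSlackOneKillsB2Z59Rows2
import Summits.MatrixMultiplication.OmegaCensus.STPPVosperSlackOneKillsB2Z59Rows3
import Summits.MatrixMultiplication.OmegaCensus.STPPVosperSlackOneKillsB2Z59Rows4
import Summits.MatrixMultiplication.OmegaCensus.STPPVosperSlackOneKillsB2Z59Rows5
import Summits.MatrixMultiplication.OmegaCensus.STPPVosperSlackOneKillsB2Z59Rows6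
import Summits.MatrixMultiplication.OmegaCensus.STPP222SqSymmetry
import Summits.MatrixMultiplication.OmegaCensus.STPPDisjointPacking

/-!
# ω-census (abelian STPP census): two SLACK-1 kills at `ℤ₅₉` by the `b = 2` law (kernel, modulo Hamidoune–Rødseth)

HONEST FRAMING (pub-omega census; verbatim): lottery ticket; floor = certified bounds/negative ranges.
Census STRUCTURE (seat pub-omega-stpp-1 gen 30, 2026-08-28), family (b2).  Applications of `no_isSTPP_of_slack_one_tables_prime_b2`
(`STPPVosperSlackOneLawB2.lean`): the `Bᵢ`-side (`b = 2`) is elementary (two maximal runs, two windows), the `Aᵢ`-side (`a = 4`) uses Hamidoune–Rødseth,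
so ALL THREE THEOREMS ARE CONDITIONAL on `HamidouneRodsethInverseTheorem` (stated as printed in `STPPVosperSlackOneSteps.lean`, NOT proved in the tree).
Nothing here is progress on `ω`.

| order | pattern | reading | block | `(z, b, vol, a, L)` | `(n, m)` | target `J = {0, ±1, ±2⁻¹, ±3⁻¹}` |
|---|---|---|---|---|---|---|
| 61 | `{(1,1,2),(2,3,2),(4,2,3),(4,2,3)}` | `(a,b,c)` | `(4,2,3)` | `(18, 2, 24, 4, 14)` | `(41, 17)` | `{0, 1, 60, 31, 30, 41, 20}` |
| 59 | `{(2,2,3),(2,4,3),(2,4,3)}` | `(b,a,c) = (−B,−A,−C)` | `(4,2,3)` | `(18, 2, 24, 4, 12)` | `(39, 15)` | `{0, 1, 58, 30, 29, 20, 39}` |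
| 59 | `{(2,3,3),(2,3,3),(2,3,4)}` | `(c,a,b)` | `(4,2,3)` | `(18, 2, 24, 4, 12)` | `(39, 15)` | `{0, 1, 58, 30, 29, 20, 39}` |

The `ℤ₆₁` pattern is a kernel-open, ENGINE-dead leaf of the joined `ℤ₆₁` front (OMEGA-TABLE NR257/NR258); the two `ℤ₅₉` patterns are leaves of the `ℤ₅₉`
residual front of record not killed by the tight laws (HOME `pub-omega-stpp-1-g29/scan/KERNEL-KILLS-Z59.json`).  The case-β₂ table is ASSEMBLED from row chunks (`…KillsB2Z59Rows*.lean`, one `decide +kernel` each).  Independent python reading of the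
tables: HOME `pub-omega-stpp-1-g30/code/lean_tables.py` (γ, α) and `code/beta2_mirror.py` (β₂), all `True`.

References: Y. O. Hamidoune, Ø. J. Rødseth, Acta Arith. 92 (2000) 251–262; A. G. Vosper, J. London Math. Soc. 31 (1956); M. B. Nathanson, GTM 165,
Thm 2.7; H. Cohn, R. Kleinberg, B. Szegedy, C. Umans, FOCS 2005 (arXiv:math/0511460), Def. 5.1.
-/

open Finset
open scoped Pointwise

namespace Summit.MatrixMultiplication.OmegaCensus.CubeNB

open Literature.Computability.AlgebraicComplexity
open Literature.Combinatorics.Additive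
open Summit.MatrixMultiplication.OmegaCensus.STPPKneser

/-! ## Targets and tables -/

section Tables

/-- Target at `59` for `(a, b) = (4, 2)`: `0`, `±1`, `±2⁻¹ = 30, 29`, `±3⁻¹ = 20, 39`. [folklore] -/
theorem target_59_a4_b2 : ∀ jv ∈ ({0, 1, 58, 30, 29, 20, 39} : Finset ℕ),
    jv = 0 ∨ (∃ k ∈ range 2, 1 ≤ k ∧ (jv = k ∨ jv + k = 59)) ∨ (∃ k ∈ range 4, 1 ≤ k ∧ (jv * k % 59 = 1 ∨ jv * k % 59 = 59 - 1)) := by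
  decide

/-- Tight-type table `(39, 15, 2)` at `59`, target `{0, ±1, ±2⁻¹, ±3⁻¹}`. [folklore] -/
theorem table59_39_15_2_a4b2 : ∀ j < 59, ∀ t < 59, (∀ i < 15, (t + j * i) % 59 < 39) →
    (∀ k < 15, 2 ∣ (t + j * k) % 59 - #((range 15).filter fun i => (t + j * i) % 59 < (t + j * k) % 59)) →
    j ∈ ({0, 1, 58, 30, 29, 20, 39} : Finset ℕ) := by
  decide +kernel

/-- Case-α table `(40, 17, 2)` at `59`, target `{0, ±1, ±2⁻¹, ±3⁻¹}`. [folklore] -/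
theorem tableAlpha59_40_17_2_a4b2 : tableAlpha 59 40 17 2 {0, 1, 58, 30, 29, 20, 39} = true := by
  decide +kernel

/-- Case-β₂ table `(n, m) = (39, 15)` at `59`, assembled from its row chunks. [folklore] -/
theorem tableBeta2_59_39_15 : tableBeta2 59 39 15 {0, 1, 58, 30, 29, 20, 39} = true := by
  rw [tableBeta2, List.all_eq_true]
  intro j hj
  have hj' := List.mem_range.1 hj
  by_cases h0 : j < 10
  · exact List.all_eq_true.1 tableBeta2_59_39_15_rows_0_10 j (List.mem_range'_1.2 ⟨by omega, by omega⟩)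
  by_cases h1 : j < 20
  · exact List.all_eq_true.1 tableBeta2_59_39_15_rows_10_20 j (List.mem_range'_1.2 ⟨by omega, by omega⟩)
  by_cases h2 : j < 30
  · exact List.all_eq_true.1 tableBeta2_59_39_15_rows_20_30 j (List.mem_range'_1.2 ⟨by omega, by omega⟩)
  by_cases h3 : j < 40
  · exact List.all_eq_true.1 tableBeta2_59_39_15_rows_30_40 j (List.mem_range'_1.2 ⟨by omega, by omega⟩)
  by_cases h4 : j < 50
  · exact List.all_eq_true.1 tableBeta2_59_39_15_rows_40_50 j (List.mem_range'_1.2 ⟨by omega, by omega⟩)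
  by_cases h5 : j < 59
  · exact List.all_eq_true.1 tableBeta2_59_39_15_rows_50_59 j (List.mem_range'_1.2 ⟨by omega, by omega⟩)
  omega

end Tables

/-! ## The conditional kills -/

section Kills

/-- **`{(2,2,3),(2,4,3),(2,4,3)}` has no STPP family in `ℤ/59ℤ`, PROVIDED the Hamidoune–Rødseth inverse theorem** (`b = 2` slack-1 law, reading
`(b,a,c)`, i.e. for `(−B,−A,−C)`, block `(4,2,3)`: `(z, b, vol, a, L) = (18, 2, 24, 4, 12)`).
[cite: CohnKleinbergSzegedyUmans2005, Def. 5.1] [cite: HamidouneRodseth2000, main theorem (§1, p. 252)] [cite: Nathanson1996, Thm 2.7] -/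
theorem no_isSTPP_zmod59_223_243_243_of_hamidouneRodseth (hHR : HamidouneRodsethInverseTheorem)
    (A B C : Fin 3 → Finset (ZMod 59)) (hS : IsSTPP A B C)
    (hA : ∀ i, #(A i) = ![2, 2, 2] i) (hB : ∀ i, #(B i) = ![2, 4, 4] i) (hC : ∀ i, #(C i) = ![3, 3, 3] i) :
    False := by
  haveI : Fact (Nat.Prime 59) := ⟨by norm_num⟩
  have hAne : ∀ i, (A i).Nonempty := fun i => card_pos.1 (by rw [hA]; fin_cases i <;> simp)
  have hBne : ∀ i, (B i).Nonempty := fun i => card_pos.1 (by rw [hB]; fin_cases i <;> simp)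
  have hCne : ∀ i, (C i).Nonempty := fun i => card_pos.1 (by rw [hC]; fin_cases i <;> simp)
  -- the family (−B, −A, −C)
  set A' : Fin 3 → Finset (ZMod 59) := fun t => (B t).image Neg.neg with hA'
  set B' : Fin 3 → Finset (ZMod 59) := fun t => (A t).image Neg.neg with hB'
  set C' : Fin 3 → Finset (ZMod 59) := fun t => (C t).image Neg.neg with hC'
  have hS' : IsSTPP A' B' C' := STPP222SqNeg.isSTPP_negSwap (stpp_rotate hS)
  have hcA' : ∀ t, #(A' t) = #(B t) := fun t => Finset.card_image_of_injective _ neg_injective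
  have hcB' : ∀ t, #(B' t) = #(A t) := fun t => Finset.card_image_of_injective _ neg_injective
  have hcC' : ∀ t, #(C' t) = #(C t) := fun t => Finset.card_image_of_injective _ neg_injective
  have hAne' : ∀ t, (A' t).Nonempty := fun t => (hBne t).image _
  have hBne' : ∀ t, (B' t).Nonempty := fun t => (hAne t).image _
  have hCne' : ∀ t, (C' t).Nonempty := fun t => (hCne t).image _
  have e1 : (univ : Finset (Fin 3)).erase 1 = {0, 2} := by decide
  have hz : ∑ k ∈ (univ : Finset (Fin 3)).erase 1, #(A' k) * #(C' k) = 18 := by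
    rw [e1, Finset.sum_pair (by decide)]; simp [hcA', hcC', hB, hC]
  have hL : ∑ k ∈ (univ : Finset (Fin 3)).erase 1, #(B' k) * #(C' k) = 12 := by
    rw [e1, Finset.sum_pair (by decide)]; simp [hcB', hcC', hA, hC]
  have ha : #(A' 1) = 4 := by rw [hcA', hB]; simp
  have hb : #(B' 1) = 2 := by rw [hcB', hA]; simp
  have hvol : #(A' 1) * #(B' 1) * #(C' 1) = 24 := by rw [hcA', hcB', hcC', hA, hB, hC]; simp
  exact no_isSTPP_of_slack_one_tables_prime_b2 hHR A' B' C' hS' hAne' hBne' hCne' 1 ⟨0, by decide⟩ ha hb hvol hz hL (by norm_num) rfl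
    (by norm_num) (by norm_num) (by norm_num) (m := 15) (n := 39) rfl rfl target_59_a4_b2 table59_39_15_2_a4b2 tableAlpha59_40_17_2_a4b2
    tableBeta2_59_39_15

/-- **`{(2,3,3),(2,3,3),(2,3,4)}` has no STPP family in `ℤ/59ℤ`, PROVIDED the Hamidoune–Rødseth inverse theorem** (`b = 2` slack-1 law, reading `(c,a,b)`,
i.e. for `(C,A,B)` (`stpp_rotate` twice), block `(4,2,3)`: `(z, b, vol, a, L) = (18, 2, 24, 4, 12)`).
[cite: CohnKleinbergSzegedyUmans2005, Def. 5.1] [cite: HamidouneRodseth2000, main theorem (§1, p. 252)] [cite: Nathanson1996, Thm 2.7] -/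
theorem no_isSTPP_zmod59_233_233_234_of_hamidouneRodseth (hHR : HamidouneRodsethInverseTheorem)
    (A B C : Fin 3 → Finset (ZMod 59)) (hS : IsSTPP A B C)
    (hA : ∀ i, #(A i) = ![2, 2, 2] i) (hB : ∀ i, #(B i) = ![3, 3, 3] i) (hC : ∀ i, #(C i) = ![3, 3, 4] i) :
    False := by
  haveI : Fact (Nat.Prime 59) := ⟨by norm_num⟩
  have hS' : IsSTPP C A B := stpp_rotate (stpp_rotate hS)
  have hAne : ∀ i, (A i).Nonempty := fun i => card_pos.1 (by rw [hA]; fin_cases i <;> simp)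
  have hBne : ∀ i, (B i).Nonempty := fun i => card_pos.1 (by rw [hB]; fin_cases i <;> simp)
  have hCne : ∀ i, (C i).Nonempty := fun i => card_pos.1 (by rw [hC]; fin_cases i <;> simp)
  have e2 : (univ : Finset (Fin 3)).erase 2 = {0, 1} := by decide
  have hz : ∑ k ∈ (univ : Finset (Fin 3)).erase 2, #(C k) * #(B k) = 18 := by
    rw [e2, Finset.sum_pair (by decide)]; simp [hB, hC]
  have hL : ∑ k ∈ (univ : Finset (Fin 3)).erase 2, #(A k) * #(B k) = 12 := by
    rw [e2, Finset.sum_pair (by decide)]; simp [hA, hB]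
  have ha : #(C 2) = 4 := by rw [hC]; simp
  have hb : #(A 2) = 2 := by rw [hA]; simp
  have hvol : #(C 2) * #(A 2) * #(B 2) = 24 := by rw [hA, hB, hC]; simp
  exact no_isSTPP_of_slack_one_tables_prime_b2 hHR C A B hS' hCne hAne hBne 2 ⟨0, by decide⟩ ha hb hvol hz hL (by norm_num) rfl
    (by norm_num) (by norm_num) (by norm_num) (m := 15) (n := 39) rfl rfl target_59_a4_b2 table59_39_15_2_a4b2 tableAlpha59_40_17_2_a4b2
    tableBeta2_59_39_15

end Kills

end Summit.MatrixMultiplication.OmegaCensus.CubeNB
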